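import Mathlib.Algebra.Module.ZLattice.Covolume
import Mathlib.MeasureTheory.Integral.Pi
import Mathlib.MeasureTheory.Measure.Haar.NormedSpace
import Mathlib.MeasureTheory.Group.Integral
import Mathlib.MeasureTheory.Group.LIntegral
import HarnessLib

/-!
# Lattice sums of product weights under dilation: `∑_{ξ ∈ L} ∏ᵢ gᵢ(ξᵢ/T) ≤ covol(L)⁻¹ ∏ᵢ (4δ gᵢ(0) + 2T ∫gᵢ)`

Topic `MeasureTheory/Group`; namespace `Literature.MeasureTheory.Group`. KERNEL mathematics only (theorems;
no definition, no named fact, no `axiom`, no `sorry`; Mathlib-only imports).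

THE ESTIMATE. Let `L` be a full `ℤ`-lattice in `E = ℝ^ι` (`IsZLattice ℝ L`; sup norm, Lebesgue measure) and
let `g(x) = ∏ᵢ gᵢ(xᵢ)` be a PRODUCT WEIGHT whose factors `gᵢ : ℝ → ℝ` are non-negative, integrable and
EVEN-ANTITONE (`|s| ≤ |t| ⇒ gᵢ(t) ≤ gᵢ(s)`). Then for EVERY dilation `T > 0` and EVERY translate `a ∈ E`
`∑_{ξ ∈ L} ∏ᵢ gᵢ((a + ξ)ᵢ / T) ≤ covol(L)⁻¹ · ∏ᵢ (4δ · gᵢ(0) + 2T · ∫ gᵢ)`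
(`exists_forall_tsum_prod_apply_div_le`, with `Summable`), where `δ ≥ 0` bounds the sup norm of a
fundamental parallelepiped of `L` — UNIFORMLY in the translate `a` and in the weight; in particular
`∑_{ξ ∈ L} g((a + ξ)/T) ≤ C_L (1 + T^{|ι|}) ∏ᵢ (gᵢ(0) + ∫ gᵢ)` with the exponent EXACTLY the rank
(`exists_tsum_prod_apply_div_le`). (Shifted lattices `a + 𝒪`, i.e. the cosets of `𝒪` in a fractional ideal
`𝔡⁻¹`, are the use case: summing over `𝔡⁻¹ = ⋃ (a + 𝒪)` costs the index `N𝔡`.)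

This is the lattice-point estimate in the proof of [Weil1965, Chap. I n° 12, Lemme 5, pp. 21–22] («on a donc
`Σ_{ξ ∈ L} Φ₁(ρ(θ)ξ) ≤ C' ∏ sup(1, λ(θ)⁻¹)^{m_λ d}`» for a product majorant `∏ (1 + |x_{λi}|^γ)⁻¹`, `γ > 1`),
stated for an ARBITRARY full lattice (Weil reduces to a sublattice of the coordinate lattice, which is
only possible for lattices commensurable with it; the image of a fractional ideal of a number field
under its real embeddings is not) and proved by the cell (Riemann-sum) argument: tile `E` by the
translates `ξ + D` of a fundamental parallelepiped (Mathlib `ZLattice.isAddFundamentalDomain`), observe that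
for `y ∈ ξ + D` one has coordinatewise `|ξᵢ| ≥ |yᵢ| - δ`, whence
`gᵢ(ξᵢ/T) ≤ gᵢ(0)·𝟙_{|yᵢ| ≤ 2δ} + gᵢ(yᵢ/(2T))` (`apply_div_le_cellMajorant`), integrate over the cell,
sum over `ξ` (`IsAddFundamentalDomain.lintegral_eq_tsum`) and factor the integral of the product
(`integral_fintype_prod_volume_eq_prod`). No radial symmetry, no Poisson summation and no `T ≥ 1` is needed;
the product form is the one met by majorants that are products of local decays over the real places
of a totally real field (a radial integrable dominant would need decay exponent `>` the degree).

## References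
* [Weil1965] A. Weil, *Sur la formule de Siegel dans la théorie des groupes classiques*, Acta Math. 113
  (1965) 1–87: Chap. I n° 12, Lemme 5 and its proof, pp. 20–22.
-/

set_option autoImplicit false

noncomputable section

open _root_.MeasureTheory _root_.MeasureTheory.Measure Set Filter Finset ZSpan
open scoped ENNReal NNReal BigOperators Pointwise

namespace Literature.MeasureTheory.Group

variable {ι : Type*} [Fintype ι]

/-! ## §1 One coordinate: the cell majorant -/

/-- the CELL MAJORANT of one factor: `K(y) = g(0)·𝟙_{[-2δ, 2δ]}(y) + g(y/(2T))`.
[cite: Weil1965, Chap. I n° 12, proof of Lemme 5, pp. 21–22] -/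
theorem apply_div_le_cellMajorant {g : ℝ → ℝ} (hg0 : ∀ t, 0 ≤ g t)
    (hga : ∀ s t : ℝ, |s| ≤ |t| → g t ≤ g s) {δ T ξ y : ℝ} (hT : 0 < T) (hy : |y - ξ| ≤ δ) :
    g (ξ / T) ≤ g 0 * (Set.Icc (-(2 * δ)) (2 * δ)).indicator (fun _ => (1 : ℝ)) y + g (y / (2 * T)) := by
  by_cases h : |y| ≤ 2 * δ
  · -- near the origin: `g(ξ/T) ≤ g(0)`
    have hmem : y ∈ Set.Icc (-(2 * δ)) (2 * δ) := by
      rw [Set.mem_Icc]; constructor <;> linarith [abs_le.1 h |>.1, abs_le.1 h |>.2]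
    rw [Set.indicator_of_mem hmem, mul_one]
    have h1 : g (ξ / T) ≤ g 0 := hga 0 (ξ / T) (by simp [abs_nonneg])
    linarith [hg0 (y / (2 * T))]
  · -- away from the origin: `|ξ| ≥ |y| - δ ≥ |y|/2`, so `|ξ/T| ≥ |y/(2T)|`
    push Not at h
    have hmem : y ∉ Set.Icc (-(2 * δ)) (2 * δ) := by
      intro hm
      rw [Set.mem_Icc] at hm
      exact (not_le.2 h) (abs_le.2 ⟨by linarith [hm.1], hm.2⟩)
    rw [Set.indicator_of_notMem hmem, mul_zero, zero_add]
    refine hga _ _ ?_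
    have hξ : |y| / 2 ≤ |ξ| := by
      have := abs_sub_abs_le_abs_sub y ξ
      linarith
    rw [abs_div, abs_div, abs_of_pos hT, abs_of_pos (by positivity : (0:ℝ) < 2 * T),
      div_le_div_iff₀ (by positivity) hT]
    nlinarith

/-- the cell majorant is non-negative. [cite: Weil1965, Chap. I n° 12, proof of Lemme 5, pp. 21–22] -/
theorem cellMajorant_nonneg {g : ℝ → ℝ} (hg0 : ∀ t, 0 ≤ g t) (δ T y : ℝ) :
    0 ≤ g 0 * (Set.Icc (-(2 * δ)) (2 * δ)).indicator (fun _ => (1 : ℝ)) y + g (y / (2 * T)) :=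
  add_nonneg (mul_nonneg (hg0 0) (Set.indicator_nonneg (fun _ _ => zero_le_one) _)) (hg0 _)

/-- the cell majorant is integrable. [cite: Weil1965, Chap. I n° 12, proof of Lemme 5, pp. 21–22] -/
theorem integrable_cellMajorant {g : ℝ → ℝ} (hgi : Integrable g) (δ : ℝ) {T : ℝ} (hT : 0 < T) :
    Integrable fun y : ℝ => g 0 * (Set.Icc (-(2 * δ)) (2 * δ)).indicator (fun _ => (1 : ℝ)) y +
      g (y / (2 * T)) := by
  refine Integrable.add (Integrable.const_mul ?_ _) (hgi.comp_div (by positivity))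
  exact (integrableOn_const (measure_Icc_lt_top.ne)).integrable_indicator measurableSet_Icc

/-- `∫ K = 4δ g(0) + 2T ∫ g` (`δ ≥ 0`, `T > 0`). [cite: Weil1965, Chap. I n° 12, proof of Lemme 5, pp. 21–22] -/
theorem integral_cellMajorant {g : ℝ → ℝ} (hgi : Integrable g) {δ : ℝ} (hδ : 0 ≤ δ) {T : ℝ} (hT : 0 < T) :
    ∫ y : ℝ, (g 0 * (Set.Icc (-(2 * δ)) (2 * δ)).indicator (fun _ => (1 : ℝ)) y + g (y / (2 * T))) =
      4 * δ * g 0 + 2 * T * ∫ t, g t := by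
  have hind : Integrable fun y : ℝ => (Set.Icc (-(2 * δ)) (2 * δ)).indicator (fun _ => (1 : ℝ)) y :=
    (integrableOn_const (measure_Icc_lt_top.ne)).integrable_indicator measurableSet_Icc
  rw [integral_add (hind.const_mul _) (hgi.comp_div (by positivity)), integral_const_mul,
    integral_indicator measurableSet_Icc, setIntegral_const, Real.volume_real_Icc_of_le (by linarith),
    Measure.integral_comp_div g (2 * T), abs_of_pos (by positivity : (0:ℝ) < 2 * T), smul_eq_mul, smul_eq_mul]
  ring

/-! ## §2 The lattice sum -/

/-- a fundamental parallelepiped of a full lattice is bounded in sup norm: `∃ δ ≥ 0`, every point of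
`ZSpan.fundamentalDomain` of a `ℤ`-basis has all coordinates `≤ δ` in absolute value.
[cite: Weil1965, Chap. I n° 12, proof of Lemme 5, pp. 21–22] -/
theorem exists_forall_abs_apply_le_of_mem_fundamentalDomain {κ : Type*} [Finite κ]
    (B : Module.Basis κ ℝ (ι → ℝ)) :
    ∃ δ : ℝ, 0 ≤ δ ∧ ∀ d ∈ fundamentalDomain B, ∀ i, |d i| ≤ δ := by
  obtain ⟨δ, hδ⟩ := isBounded_iff_forall_norm_le.1 (fundamentalDomain_isBounded B)
  refine ⟨max δ 0, le_max_right _ _, fun d hd i => ?_⟩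
  exact ((Real.norm_eq_abs _).symm.le.trans (norm_le_pi_norm d i)).trans ((hδ d hd).trans (le_max_left _ _))

/-- **Lattice sums of a product weight under dilation** (the cell estimate, exact form): for a full
`ℤ`-lattice `L ⊂ ℝ^ι` there is `δ ≥ 0` (a sup-norm bound of a fundamental parallelepiped) such that for ALL
product weights with non-negative, integrable, even-antitone factors `gᵢ`, EVERY `T > 0` and EVERY translate
`a ∈ ℝ^ι`, the family `ξ ↦ ∏ᵢ gᵢ((a + ξ)ᵢ/T)` is summable over `L` and
`∑_{ξ ∈ L} ∏ᵢ gᵢ((a + ξ)ᵢ/T) ≤ covol(L)⁻¹ ∏ᵢ (4δ gᵢ(0) + 2T ∫ gᵢ)` (uniform in `a`: the shifted cells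
`ξ + D` still tile, and `∫ K(· + a) = ∫ K`).
[cite: Weil1965, Chap. I n° 12, proof of Lemme 5, pp. 21–22] -/
theorem exists_forall_tsum_prod_apply_div_le (L : Submodule ℤ (ι → ℝ)) [DiscreteTopology L]
    [IsZLattice ℝ L] :
    ∃ δ : ℝ, 0 ≤ δ ∧ ∀ (g : ι → ℝ → ℝ), (∀ i t, 0 ≤ g i t) → (∀ i (s t : ℝ), |s| ≤ |t| → g i t ≤ g i s) →
      (∀ i, Integrable (g i)) → ∀ T : ℝ, 0 < T → ∀ a : ι → ℝ,
        Summable (fun ξ : L => ∏ i, g i ((a + (ξ : ι → ℝ)) i / T)) ∧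
        ∑' ξ : L, ∏ i, g i ((a + (ξ : ι → ℝ)) i / T) ≤
          (ZLattice.covolume L)⁻¹ * ∏ i, (4 * δ * g i 0 + 2 * T * ∫ t, g i t) := by
  classical
  -- a fundamental parallelepiped `D` of `L`, its sup-norm bound `δ`, its volume = covolume
  set b := Module.Free.chooseBasis ℤ L with hb
  set B : Module.Basis _ ℝ (ι → ℝ) := b.ofZLatticeBasis ℝ L with hB
  set D : Set (ι → ℝ) := fundamentalDomain B with hDdef
  have hD : IsAddFundamentalDomain L D volume := ZLattice.isAddFundamentalDomain b volume
  haveI : MeasurableVAdd L (ι → ℝ) := (inferInstance : MeasurableVAdd L.toAddSubgroup (ι → ℝ))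
  haveI : VAddInvariantMeasure L (ι → ℝ) volume :=
    (inferInstance : VAddInvariantMeasure L.toAddSubgroup (ι → ℝ) volume)
  obtain ⟨δ, hδ0, hδ⟩ := exists_forall_abs_apply_le_of_mem_fundamentalDomain B
  have hcov : ZLattice.covolume L = volume.real D := ZLattice.covolume_eq_measure_fundamentalDomain L volume hD
  have hcovpos : 0 < ZLattice.covolume L := ZLattice.covolume_pos L volume
  have hDtop : volume D ≠ ⊤ := (fundamentalDomain_isBounded B).measure_lt_top.ne
  have hDreal : volume D = ENNReal.ofReal (volume.real D) := (ENNReal.ofReal_toReal hDtop).symm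
  refine ⟨δ, hδ0, fun g hg0 hga hgi T hT a => ?_⟩
  -- the weight and the cell majorant
  set w : L → ℝ := fun ξ => ∏ i, g i ((a + (ξ : ι → ℝ)) i / T) with hw
  have hw0 : ∀ ξ, 0 ≤ w ξ := fun ξ => Finset.prod_nonneg fun i _ => hg0 i _
  set Kc : ι → ℝ → ℝ := fun i y =>
    g i 0 * (Set.Icc (-(2 * δ)) (2 * δ)).indicator (fun _ => (1 : ℝ)) y + g i (y / (2 * T)) with hKc
  set K : (ι → ℝ) → ℝ := fun y => ∏ i, Kc i (y i) with hK
  have hK0 : ∀ y, 0 ≤ K y := fun y => Finset.prod_nonneg fun i _ => cellMajorant_nonneg (hg0 i) δ T (y i)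
  have hKint : Integrable K := by
    have h := Integrable.fintype_prod (ι := ι) (𝕜 := ℝ) (μ := fun _ : ι => (volume : Measure ℝ))
      (f := Kc) fun i => integrable_cellMajorant (hgi i) δ hT
    rw [hK, volume_pi]
    exact h
  have hKI : ∫ y, K y = ∏ i, (4 * δ * g i 0 + 2 * T * ∫ t, g i t) := by
    rw [hK]
    rw [integral_fintype_prod_volume_eq_prod (𝕜 := ℝ) (fun i => Kc i)]
    exact Finset.prod_congr rfl fun i _ => integral_cellMajorant (hgi i) hδ0 hT
  -- (1) the cell inequality: on `ξ + D` the constant `w ξ` is below `K(· + a)`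
  have hcell : ∀ (ξ : L) (y : ι → ℝ), y ∈ ξ +ᵥ D → w ξ ≤ K (y + a) := by
    intro ξ y hy
    obtain ⟨d, hd, rfl⟩ := Set.mem_vadd_set.1 hy
    rw [Submodule.vadd_def, vadd_eq_add]
    refine Finset.prod_le_prod (fun i _ => hg0 i _) fun i _ => ?_
    refine apply_div_le_cellMajorant (hg0 i) (hga i) hT ?_
    simpa [add_comm, add_assoc] using hδ d hd i
  -- (2) integrate over the cell and sum over the lattice (in `ℝ≥0∞`)
  have hsum : (∑' ξ : L, ENNReal.ofReal (w ξ)) * volume D ≤ ENNReal.ofReal (∫ y, K y) := by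
    have hvol : ∀ ξ : L, volume (ξ +ᵥ D) = volume D := fun ξ => by
      rw [show ξ +ᵥ D = (ξ : ι → ℝ) +ᵥ D from by
        ext y; simp only [Set.mem_vadd_set, Submodule.vadd_def]]
      exact measure_vadd _ _ _
    calc (∑' ξ : L, ENNReal.ofReal (w ξ)) * volume D
        = ∑' ξ : L, ENNReal.ofReal (w ξ) * volume (ξ +ᵥ D) := by
          rw [← ENNReal.tsum_mul_right]; exact tsum_congr fun ξ => by rw [hvol ξ]
      _ = ∑' ξ : L, ∫⁻ y in ξ +ᵥ D, ENNReal.ofReal (w ξ) := tsum_congr fun ξ => by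
          rw [setLIntegral_const]
      _ ≤ ∑' ξ : L, ∫⁻ y in ξ +ᵥ D, ENNReal.ofReal (K (y + a)) := by
          refine ENNReal.tsum_le_tsum fun ξ => setLIntegral_mono_ae ?_ ?_
          · exact (ENNReal.measurable_ofReal.comp_aemeasurable
              (hKint.comp_add_right a).1.aemeasurable).restrict
          · exact ae_of_all _ fun y hy => ENNReal.ofReal_le_ofReal (hcell ξ y hy)
      _ = ∫⁻ y, ENNReal.ofReal (K (y + a)) := (hD.lintegral_eq_tsum fun y => ENNReal.ofReal (K (y + a))).symm
      _ = ∫⁻ y, ENNReal.ofReal (K y) := lintegral_add_right_eq_self (fun y => ENNReal.ofReal (K y)) a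
      _ = ENNReal.ofReal (∫ y, K y) := (ofReal_integral_eq_lintegral_ofReal hKint (ae_of_all _ hK0)).symm
  -- (3) back to `ℝ`: every finite partial sum is bounded by `covol⁻¹ ∫ K`
  have hbound : ∀ s : Finset L, ∑ ξ ∈ s, w ξ ≤ (ZLattice.covolume L)⁻¹ * ∫ y, K y := by
    intro s
    have h1 : ENNReal.ofReal (∑ ξ ∈ s, w ξ) * volume D ≤ ENNReal.ofReal (∫ y, K y) := by
      calc ENNReal.ofReal (∑ ξ ∈ s, w ξ) * volume D = (∑ ξ ∈ s, ENNReal.ofReal (w ξ)) * volume D := by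
            rw [ENNReal.ofReal_sum_of_nonneg fun ξ _ => hw0 ξ]
        _ ≤ (∑' ξ : L, ENNReal.ofReal (w ξ)) * volume D := by
            gcongr; exact ENNReal.sum_le_tsum s
        _ ≤ ENNReal.ofReal (∫ y, K y) := hsum
    rw [hDreal, ← ENNReal.ofReal_mul (Finset.sum_nonneg fun ξ _ => hw0 ξ),
      ENNReal.ofReal_le_ofReal_iff (integral_nonneg hK0)] at h1
    rw [hcov, inv_mul_eq_div, le_div_iff₀ (by rw [← hcov]; exact hcovpos)]
    exact h1
  have hS : Summable w := summable_of_sum_le hw0 hbound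
  refine ⟨hS, ?_⟩
  have hfin : ∑' ξ : L, w ξ ≤ (ZLattice.covolume L)⁻¹ * ∫ y, K y := hS.tsum_le_of_sum_le hbound
  rw [hKI] at hfin
  exact hfin

/-- elementary: `4δ a + 2T b ≤ max(4δ, 2) (1 + T) (a + b)` for `a, b, T ≥ 0`. [folklore] -/
private theorem cell_factor_le {δ T a b : ℝ} (hT : 0 ≤ T) (ha : 0 ≤ a) (hb : 0 ≤ b) :
    4 * δ * a + 2 * T * b ≤ max (4 * δ) 2 * (1 + T) * (a + b) := by
  have h1 : 4 * δ * a ≤ max (4 * δ) 2 * (1 + T) * a := by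
    have : 4 * δ ≤ max (4 * δ) 2 * (1 + T) :=
      (le_max_left _ _).trans (le_mul_of_one_le_right (le_max_of_le_right zero_le_two) (by linarith))
    exact mul_le_mul_of_nonneg_right this ha
  have h2 : 2 * T * b ≤ max (4 * δ) 2 * (1 + T) * b := by
    have : 2 * T ≤ max (4 * δ) 2 * (1 + T) := by
      calc 2 * T ≤ 2 * (1 + T) := by linarith
        _ ≤ max (4 * δ) 2 * (1 + T) := mul_le_mul_of_nonneg_right (le_max_right _ _) (by linarith)
    exact mul_le_mul_of_nonneg_right this hb
  nlinarith

/-- elementary: `(1 + T)^n ≤ 2^n (1 + T^n)` for `T ≥ 0`. [folklore] -/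
private theorem one_add_pow_le_two_pow_mul {T : ℝ} (hT : 0 ≤ T) (n : ℕ) :
    (1 + T) ^ n ≤ 2 ^ n * (1 + T ^ n) := by
  have h : 1 + T ≤ 2 * max 1 T := by
    rcases le_total 1 T with h | h
    · rw [max_eq_right h]; linarith
    · rw [max_eq_left h]; linarith
  calc (1 + T) ^ n ≤ (2 * max 1 T) ^ n := pow_le_pow_left₀ (by linarith) h n
    _ = 2 ^ n * (max 1 T) ^ n := mul_pow _ _ _
    _ ≤ 2 ^ n * (1 + T ^ n) := by
        gcongr
        rcases le_total 1 T with h | h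
        · rw [max_eq_right h]; linarith [pow_nonneg (zero_le_one.trans h) n]
        · rw [max_eq_left h, one_pow]; linarith [pow_nonneg hT n]

/-- **Lattice sums of a product weight under dilation** (the shape consumed downstream): there is a
constant `C` depending only on the lattice such that for every admissible product weight, every `T > 0` and
every translate `a`, `∑_{ξ ∈ L} ∏ᵢ gᵢ((a + ξ)ᵢ/T) ≤ C (1 + T ^ |ι|) ∏ᵢ (gᵢ(0) + ∫ gᵢ)` — the exponent of `T`
is exactly the rank.
[cite: Weil1965, Chap. I n° 12, proof of Lemme 5, pp. 21–22] -/
theorem exists_tsum_prod_apply_div_le (L : Submodule ℤ (ι → ℝ)) [DiscreteTopology L] [IsZLattice ℝ L] :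
    ∃ C : ℝ, 0 ≤ C ∧ ∀ (g : ι → ℝ → ℝ), (∀ i t, 0 ≤ g i t) → (∀ i (s t : ℝ), |s| ≤ |t| → g i t ≤ g i s) →
      (∀ i, Integrable (g i)) → ∀ T : ℝ, 0 < T → ∀ a : ι → ℝ,
        Summable (fun ξ : L => ∏ i, g i ((a + (ξ : ι → ℝ)) i / T)) ∧
        ∑' ξ : L, ∏ i, g i ((a + (ξ : ι → ℝ)) i / T) ≤
          C * (1 + T ^ Fintype.card ι) * ∏ i, (g i 0 + ∫ t, g i t) := by
  obtain ⟨δ, hδ0, h⟩ := exists_forall_tsum_prod_apply_div_le L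
  set M : ℝ := max (4 * δ) 2 with hM
  have hM0 : 0 ≤ M := le_max_of_le_right zero_le_two
  have hcov0 : 0 ≤ (ZLattice.covolume L)⁻¹ := inv_nonneg.2 (ZLattice.covolume_pos L volume).le
  refine ⟨(ZLattice.covolume L)⁻¹ * (M ^ Fintype.card ι * 2 ^ Fintype.card ι),
    mul_nonneg hcov0 (by positivity), fun g hg0 hga hgi T hT a => ?_⟩
  obtain ⟨hS, hle⟩ := h g hg0 hga hgi T hT a
  refine ⟨hS, hle.trans ?_⟩
  have hint0 : ∀ i, 0 ≤ ∫ t, g i t := fun i => integral_nonneg (hg0 i)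
  -- `∏ (4δ gᵢ 0 + 2T ∫gᵢ) ≤ M^n (1+T)^n ∏ (gᵢ 0 + ∫gᵢ) ≤ M^n 2^n (1 + T^n) ∏ (gᵢ 0 + ∫gᵢ)`
  have hprod : ∏ i, (4 * δ * g i 0 + 2 * T * ∫ t, g i t) ≤
      (M * (1 + T)) ^ Fintype.card ι * ∏ i, (g i 0 + ∫ t, g i t) := by
    calc ∏ i, (4 * δ * g i 0 + 2 * T * ∫ t, g i t) ≤ ∏ i, (M * (1 + T) * (g i 0 + ∫ t, g i t)) :=
          Finset.prod_le_prod (fun i _ => by nlinarith [hg0 i 0, hint0 i, hT.le])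
            fun i _ => cell_factor_le hT.le (hg0 i 0) (hint0 i)
      _ = (M * (1 + T)) ^ Fintype.card ι * ∏ i, (g i 0 + ∫ t, g i t) := by
          rw [Finset.prod_mul_distrib, Finset.prod_const, Finset.card_univ]
  have hP0 : 0 ≤ ∏ i, (g i 0 + ∫ t, g i t) := Finset.prod_nonneg fun i _ => add_nonneg (hg0 i 0) (hint0 i)
  calc (ZLattice.covolume L)⁻¹ * ∏ i, (4 * δ * g i 0 + 2 * T * ∫ t, g i t)
      ≤ (ZLattice.covolume L)⁻¹ * ((M * (1 + T)) ^ Fintype.card ι * ∏ i, (g i 0 + ∫ t, g i t)) :=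
        mul_le_mul_of_nonneg_left hprod hcov0
    _ ≤ (ZLattice.covolume L)⁻¹ * (M ^ Fintype.card ι * (2 ^ Fintype.card ι * (1 + T ^ Fintype.card ι)) *
          ∏ i, (g i 0 + ∫ t, g i t)) := by
        gcongr
        rw [mul_pow]
        exact mul_le_mul_of_nonneg_left (one_add_pow_le_two_pow_mul hT.le _) (pow_nonneg hM0 _)
    _ = (ZLattice.covolume L)⁻¹ * (M ^ Fintype.card ι * 2 ^ Fintype.card ι) * (1 + T ^ Fintype.card ι) *
          ∏ i, (g i 0 + ∫ t, g i t) := by ring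

end Literature.MeasureTheory.Group
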